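import Literature.Geometry.Lorentzian.RiemannianVolumeIsometry
import Literature.Geometry.Riemannian.RiemannianMeasureIsometry
import Mathlib.Geometry.Manifold.LocalDiffeomorph
import HarnessLib

/-!
# The volume of a finite-sheeted Riemannian covering: `Vol(M̃) = k · Vol(M)`

For a smooth map `F : M₁ → M₂` between Riemannian manifolds of the same dimension which is a
**local isometry** — a local diffeomorphism with `g₂(dF v, dF w) = g₁(v, w)` — we PROVE:

* `edist_comp_le_of_isometric` — `F` does not increase the Riemannian distance
  (`d₂(F x, F y) ≤ d₁(x, y)`, O'Neill 1983, Ch. 3, p. 90);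
* `exists_nhds_edist_comp_eq` — **a local isometry is locally distance-preserving**: every point
  has a neighbourhood `U` on which `d₂(F x, F y) = d₁(x, y)` and `F` is injective (short paths
  from `F x` stay inside the source of a local inverse `G` of `F`, along which `G` preserves arc
  length; Lee 2018, proof of Thm. 6.23 / Prop. 2.51);
* `euclideanHausdorffMeasure_image_eq_of_edist_eq` — a map distance-preserving on a set `U`
  preserves the (Euclidean-normalised) Hausdorff measures of subsets of `U` (Federer 1969,
  §2.10.11, applied on the subspace `U`); hence `riemannianMeasure_image_eq_of_subset` —
  `Vol_{g₂}(F(A)) = Vol_{g₁}(A)` for `A ⊆ U`;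
* `riemannianMeasure_univ_eq_mul_of_card_fibre` — **the volume of a `k`-sheeted covering**: if
  `M₁` is compact, `F` is onto and every fibre of `F` has exactly `k` points, then
  `Vol_{g₁}(M₁) = k · Vol_{g₂}(M₂)` (Lee 2018, Problem 2-14 / Chavel 2006, Exercise IV.18 for
  Riemannian coverings: evenly covered neighbourhoods are measured `k` times upstairs; here the
  evenly covered neighbourhood of `y` is built from the `k` distance-preserving neighbourhoods of
  the fibre, separated by the Hausdorff property, and the count is globalised over a finite
  measurable partition of `M₂` subordinate to them).

First use: `Vol(S³(2)/Γ) = 16π²/|Γ|` in the classification of three-dimensional gradient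
shrinking Ricci solitons (`ThreeShrinkerClassification.lean`, disjunct (a)), through the local
isometry `S³ → N` of the Killing–Hopf theorem (`SphereLocalIsometry.lean`,
`KillingHopfPositive.lean`). Everything is proved; no definitions, no named facts (D-0026).

## References

* J. M. Lee, *Introduction to Riemannian Manifolds*, 2nd ed. (2018), Prop. 2.51, Thm. 6.23,
  Problem 2-14 (`Vol(M̃) = k · Vol(M)` for a `k`-sheeted Riemannian covering). [Lee2018]
* I. Chavel, *Riemannian Geometry: A Modern Introduction*, 2nd ed. (2006), §IV.1
  (Riemannian coverings), Exercise IV.18 (`V(M) = V(M_o) · card Γ`). [Chavel2006]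
* B. O'Neill, *Semi-Riemannian geometry* (1983), Ch. 3, p. 90; Ch. 5, Def. 15. [ONeill1983]
* H. Federer, *Geometric Measure Theory* (1969), §2.10.11, §3.2.46. [Federer1969]
-/

noncomputable section

open Bundle Set Function Filter MeasureTheory Manifold Module
open scoped Manifold ContDiff Topology ENNReal NNReal

namespace Literature.Geometry.Riemannian

open Lorentzian Lorentzian.PseudoRiemannianMetric

namespace RiemannianCovering

variable {E₁ : Type*} [NormedAddCommGroup E₁] [NormedSpace ℝ E₁] [FiniteDimensional ℝ E₁]
  {H₁ : Type*} [TopologicalSpace H₁] {I₁ : ModelWithCorners ℝ E₁ H₁}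
  {M₁ : Type*} [TopologicalSpace M₁] [ChartedSpace H₁ M₁] [IsManifold I₁ ∞ M₁]
  {E₂ : Type*} [NormedAddCommGroup E₂] [NormedSpace ℝ E₂] [FiniteDimensional ℝ E₂]
  {H₂ : Type*} [TopologicalSpace H₂] {I₂ : ModelWithCorners ℝ E₂ H₂}
  {M₂ : Type*} [TopologicalSpace M₂] [ChartedSpace H₂ M₂] [IsManifold I₂ ∞ M₂]
  {g₁ : PseudoRiemannianMetric I₁ ∞ E₁ (TangentSpace I₁ : M₁ → Type _)}
  {g₂ : PseudoRiemannianMetric I₂ ∞ E₂ (TangentSpace I₂ : M₂ → Type _)}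
  {F : M₁ → M₂}

/-! ### Local isometries do not increase, and locally preserve, the Riemannian distance -/

/-- The differential of a map with `g₂(dF v, dF w) = g₁(v, w)` preserves the norms
`|v| = g(v,v)^{1/2}` of the Riemannian bundles of `g₁`, `g₂`. [cite: ONeill1983, Ch. 3, p. 90] -/
theorem norm_mfderiv_eq (hg₁ : g₁.IsRiemannian) (hg₂ : g₂.IsRiemannian)
    (hiso : ∀ (x : M₁) (v w : TangentSpace I₁ x),
      g₂.val (F x) (mfderiv I₁ I₂ F x v) (mfderiv I₁ I₂ F x w) = g₁.val x v w)
    (x : M₁) (v : TangentSpace I₁ x) :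
    letI := g₁.riemannianBundle hg₁
    letI := g₂.riemannianBundle hg₂
    ‖mfderiv I₁ I₂ F x v‖ = ‖v‖ := by
  letI := g₁.riemannianBundle hg₁
  letI := g₂.riemannianBundle hg₂
  rw [g₂.norm_eq_sqrt hg₂, g₁.norm_eq_sqrt hg₁, hiso]

/-- **A `C¹` map with isometric differential does not increase the Riemannian distance**:
`d₂(F x, F y) ≤ d₁(x, y)` (O'Neill 1983, Ch. 3, p. 90). [cite: ONeill1983, Ch. 3, p. 90] -/
theorem edist_comp_le_of_isometric (hg₁ : g₁.IsRiemannian) (hg₂ : g₂.IsRiemannian)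
    (hF : ContMDiff I₁ I₂ 1 F)
    (hiso : ∀ (x : M₁) (v w : TangentSpace I₁ x),
      g₂.val (F x) (mfderiv I₁ I₂ F x v) (mfderiv I₁ I₂ F x w) = g₁.val x v w)
    (x y : M₁) : g₂.edist hg₂ (F x) (F y) ≤ g₁.edist hg₁ x y := by
  letI := g₁.riemannianBundle hg₁
  letI := g₂.riemannianBundle hg₂
  exact Lorentzian.riemannianEDist_comp_le hF (fun x v ↦ (norm_mfderiv_eq hg₁ hg₂ hiso x v).le) x y

/-- **The local inverse of a local isometry has isometric differential**: if `F` is a local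
diffeomorphism at `x₀` with `g₂(dF v, dF w) = g₁(v, w)`, then on the source of the local inverse
`G` of `F`, `|dG w| = |w|` (differentiate `F ∘ G = id`). [cite: Lee2018, Prop. 2.51] -/
theorem norm_mfderiv_localInverse_eq (hg₁ : g₁.IsRiemannian) (hg₂ : g₂.IsRiemannian)
    (hF : ContMDiff I₁ I₂ 1 F)
    (hiso : ∀ (x : M₁) (v w : TangentSpace I₁ x),
      g₂.val (F x) (mfderiv I₁ I₂ F x v) (mfderiv I₁ I₂ F x w) = g₁.val x v w)
    {x₀ : M₁} (hloc : IsLocalDiffeomorphAt I₁ I₂ ∞ F x₀) {y : M₂}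
    (hy : y ∈ hloc.localInverse.source) (w : TangentSpace I₂ y) :
    letI := g₁.riemannianBundle hg₁
    letI := g₂.riemannianBundle hg₂
    ‖mfderiv I₂ I₁ hloc.localInverse y w‖ = ‖w‖ := by
  letI := g₁.riemannianBundle hg₁
  letI := g₂.riemannianBundle hg₂
  have h1 : (1 : ℕ∞ω) ≤ ((⊤ : ℕ∞) : ℕ∞ω) := by exact_mod_cast (le_top : (1 : ℕ∞) ≤ ⊤)
  have hGd : MDifferentiableAt I₂ I₁ hloc.localInverse y :=
    ((hloc.localInverse_contMDiffOn.of_le h1).mdifferentiableOn one_ne_zero y hy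
      ).mdifferentiableAt (hloc.localInverse.open_source.mem_nhds hy)
  have hFd : MDifferentiableAt I₁ I₂ F (hloc.localInverse y) :=
    (hF (hloc.localInverse y)).mdifferentiableAt one_ne_zero
  have hcomp : mfderiv I₂ I₂ (F ∘ hloc.localInverse) y =
      (mfderiv I₁ I₂ F (hloc.localInverse y)).comp (mfderiv I₂ I₁ hloc.localInverse y) :=
    mfderiv_comp y hFd hGd
  have hev : F ∘ hloc.localInverse =ᶠ[𝓝 y] id :=
    Filter.eventuallyEq_of_mem (hloc.localInverse.open_source.mem_nhds hy)
      hloc.localInverse_eqOn_right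
  have hid : mfderiv I₂ I₂ (F ∘ hloc.localInverse) y =
      ContinuousLinearMap.id ℝ (TangentSpace I₂ y) := by
    rw [hev.mfderiv_eq, mfderiv_id]
  have happ : mfderiv I₁ I₂ F (hloc.localInverse y) (mfderiv I₂ I₁ hloc.localInverse y w) = w :=
    DFunLike.congr_fun (hcomp.symm.trans hid) w
  have hright : F (hloc.localInverse y) = y := hloc.localInverse_right_inv hy
  rw [← norm_mfderiv_eq hg₁ hg₂ hiso (hloc.localInverse y) (mfderiv I₂ I₁ hloc.localInverse y w),
    happ]
  exact congrArg (fun z : M₂ ↦ ‖(show TangentSpace I₂ z from w)‖) hright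

/-- **A local isometry is locally distance-preserving and injective.** If `F` is `C¹` with
`g₂(dF v, dF w) = g₁(v, w)` and a `C^∞` local diffeomorphism at `x₀`, there is an open `U ∋ x₀`
on which `F` is injective and `d₂(F x, F y) = d₁(x, y)`. Proof (Lee 2018, proof of Thm. 6.23,
with Prop. 2.51): `≤` always holds; for `≥`, let `G` be a local inverse of `F` near `F x₀` whose
source contains the ball `B(F x₀, 3ρ)`, and `U = G.target ∩ F⁻¹ B(F x₀, ρ)`; for `x, y ∈ U` every
`C¹` path from `F x` to `F y` of length `< 2ρ` stays in `B(F x₀, 3ρ)`, so `G` carries it to a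
path from `x` to `y` of the same length, whence `d₁(x, y) ≤ d₂(F x, F y)`.
[cite: Lee2018, Thm. 6.23 (proof) and Prop. 2.51] -/
theorem exists_nhds_edist_comp_eq [RegularSpace M₂] (hg₁ : g₁.IsRiemannian)
    (hg₂ : g₂.IsRiemannian) (hF : ContMDiff I₁ I₂ 1 F)
    (hiso : ∀ (x : M₁) (v w : TangentSpace I₁ x),
      g₂.val (F x) (mfderiv I₁ I₂ F x v) (mfderiv I₁ I₂ F x w) = g₁.val x v w)
    {x₀ : M₁} (hloc : IsLocalDiffeomorphAt I₁ I₂ ∞ F x₀) :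
    ∃ U : Set M₁, IsOpen U ∧ x₀ ∈ U ∧ InjOn F U ∧
      ∀ x ∈ U, ∀ y ∈ U, g₂.edist hg₂ (F x) (F y) = g₁.edist hg₁ x y := by
  letI := g₁.riemannianBundle hg₁
  letI := g₂.riemannianBundle hg₂
  have hone : (1 : ℕ∞ω) ≤ ((⊤ : ℕ∞) : ℕ∞ω) := by exact_mod_cast (le_top : (1 : ℕ∞) ≤ ⊤)
  -- a ball `B(F x₀, p) ⊆ G.source`, and `ρ = p/3`
  obtain ⟨r, hr, hrS⟩ := exists_setOf_edist_lt_subset hg₂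
    (hloc.localInverse.open_source.mem_nhds hloc.localInverse_mem_source)
  obtain ⟨p, hp0, hpr⟩ := ENNReal.lt_iff_exists_nnreal_btwn.1 hr
  have hp : (0 : ℝ≥0) < p := by exact_mod_cast hp0
  set ρ : ℝ≥0 := p / 3 with hρ
  have hρ0 : (0 : ℝ≥0∞) < ρ := by
    have : (0 : ℝ≥0) < ρ := by rw [hρ]; positivity
    exact_mod_cast this
  have h3ρ : (ρ : ℝ≥0∞) + (ρ + ρ) = p := by
    rw [← ENNReal.coe_add, ← ENNReal.coe_add, hρ]
    congr 1
    field_simp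
    ring
  have hballS : ∀ z, g₂.edist hg₂ (F x₀) z < p → z ∈ hloc.localInverse.source := fun z hz ↦
    hrS (lt_trans hz hpr)
  -- the neighbourhood
  set U : Set M₁ := hloc.localInverse.target ∩ F ⁻¹' {z | g₂.edist hg₂ (F x₀) z < ρ} with hU
  have hUo : IsOpen U :=
    hloc.localInverse.open_target.inter ((isOpen_setOf_edist_lt hg₂ (F x₀) ρ).preimage
      hF.continuous)
  have hx₀U : x₀ ∈ U := ⟨hloc.localInverse_mem_target, by simpa using hρ0⟩
  have hinj : InjOn F U := by
    intro x hx y hy hxy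
    rw [← hloc.localInverse_left_inv hx.1, ← hloc.localInverse_left_inv hy.1]
    exact congrArg hloc.localInverse hxy
  refine ⟨U, hUo, hx₀U, hinj, fun x hx y hy ↦ le_antisymm
    (edist_comp_le_of_isometric hg₁ hg₂ hF hiso x y) ?_⟩
  -- the reverse inequality: `d₁(x, y) ≤ d₂(F x, F y)`
  have h2ρ : g₂.edist hg₂ (F x) (F y) < ρ + ρ :=
    calc g₂.edist hg₂ (F x) (F y) ≤ g₂.edist hg₂ (F x) (F x₀) + g₂.edist hg₂ (F x₀) (F y) :=
          edist_triangle hg₂ _ _ _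
      _ < ρ + ρ := by
          rw [edist_comm hg₂]
          exact ENNReal.add_lt_add hx.2 hy.2
  refine le_of_forall_gt_imp_ge_of_dense fun c hc ↦ ?_
  obtain ⟨c', hcc', hc'⟩ := exists_between (lt_min hc h2ρ)
  obtain ⟨hc'c, hc'ρ⟩ := lt_min_iff.1 hc'
  -- a short path from `F x` to `F y`
  obtain ⟨σ, hσ0, hσ1, hσ, hlen⟩ := exists_lt_of_riemannianEDist_lt
    (show riemannianEDist I₂ (F x) (F y) < c' from hcc')
  -- it stays in the source of `G`
  have hstay : ∀ t ∈ Icc (0 : ℝ) 1, σ t ∈ hloc.localInverse.source := by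
    intro t ht
    apply hballS
    have h1 : g₂.edist hg₂ (F x) (σ t) ≤ pathELength I₂ σ 0 1 := by
      have h := riemannianEDist_le_pathELength (I := I₂) (hσ.mono (Icc_subset_Icc_right ht.2))
        hσ0 rfl ht.1
      exact h.trans (pathELength_mono le_rfl ht.2)
    calc g₂.edist hg₂ (F x₀) (σ t) ≤ g₂.edist hg₂ (F x₀) (F x) + g₂.edist hg₂ (F x) (σ t) :=
          edist_triangle hg₂ _ _ _
      _ < ρ + (ρ + ρ) := ENNReal.add_lt_add hx.2 (h1.trans_lt (hlen.trans hc'ρ))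
      _ = p := h3ρ
  -- `G ∘ σ` is a `C¹` path from `x` to `y` of the same length
  have hGon : ContMDiffOn I₂ I₁ 1 hloc.localInverse hloc.localInverse.source :=
    hloc.localInverse_contMDiffOn.of_le hone
  have hGσ : ContMDiffOn 𝓘(ℝ, ℝ) I₁ 1 (hloc.localInverse ∘ σ) (Icc 0 1) :=
    hGon.comp hσ fun t ht ↦ hstay t ht
  have hlenG : pathELength I₁ (hloc.localInverse ∘ σ) 0 1 = pathELength I₂ σ 0 1 := by
    refine Lorentzian.pathELength_comp_eq (fun t ht ↦ ?_) (fun t ht ↦ ?_) (fun t ht w ↦ ?_)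
    · exact (hGon.mdifferentiableOn one_ne_zero _ (hstay t (Ioo_subset_Icc_self ht))
        ).mdifferentiableAt (hloc.localInverse.open_source.mem_nhds
          (hstay t (Ioo_subset_Icc_self ht)))
    · exact ((hσ t (Ioo_subset_Icc_self ht)).contMDiffAt (Icc_mem_nhds ht.1 ht.2)
        ).mdifferentiableAt one_ne_zero
    · exact norm_mfderiv_localInverse_eq hg₁ hg₂ hF hiso hloc
        (hstay t (Ioo_subset_Icc_self ht)) w
  have h0 : (hloc.localInverse ∘ σ) 0 = x := by
    rw [Function.comp_apply, hσ0]; exact hloc.localInverse_left_inv hx.1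
  have h1 : (hloc.localInverse ∘ σ) 1 = y := by
    rw [Function.comp_apply, hσ1]; exact hloc.localInverse_left_inv hy.1
  calc g₁.edist hg₁ x y ≤ pathELength I₁ (hloc.localInverse ∘ σ) 0 1 :=
        riemannianEDist_le_pathELength hGσ h0 h1 zero_le_one
    _ = pathELength I₂ σ 0 1 := hlenG
    _ ≤ c' := hlen.le
    _ ≤ c := hc'c.le

/-! ### Hausdorff measure under a map that is distance-preserving on a set -/

/-- **A map which preserves distances on a set `U` preserves the Euclidean-normalised Hausdorff
measures of subsets of `U`** (Federer 1969, §2.10.11, on the metric subspace `U`: `f|_U` is an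
isometry of `U`, and so is the inclusion `U ↪ X`). [cite: Federer1969, §2.10.11] -/
theorem euclideanHausdorffMeasure_image_eq_of_edist_eq {X Y : Type*} [EMetricSpace X]
    [MeasurableSpace X] [BorelSpace X] [EMetricSpace Y] [MeasurableSpace Y] [BorelSpace Y]
    {f : X → Y} {U A : Set X} (hU : ∀ x ∈ U, ∀ y ∈ U, edist (f x) (f y) = edist x y)
    (hA : A ⊆ U) (d : ℕ) :
    (μHE[d] : Measure Y) (f '' A) = (μHE[d] : Measure X) A := by
  have hf : Isometry (fun u : U ↦ f u) := fun u v ↦ hU u u.2 v v.2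
  have h1 := hf.hausdorffMeasure_image (Or.inl (Nat.cast_nonneg d)) (Subtype.val ⁻¹' A)
  have h2 := (isometry_subtype_coe (s := U)).hausdorffMeasure_image (Or.inl (Nat.cast_nonneg d))
    (Subtype.val ⁻¹' A)
  have himf : (fun u : U ↦ f u) '' (Subtype.val ⁻¹' A) = f '' A := by
    ext z
    constructor
    · rintro ⟨u, hu, rfl⟩
      exact ⟨u, hu, rfl⟩
    · rintro ⟨a, ha, rfl⟩
      exact ⟨⟨a, hA ha⟩, ha, rfl⟩
  have himv : (Subtype.val : U → X) '' (Subtype.val ⁻¹' A) = A := by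
    rw [Subtype.image_preimage_coe, inter_eq_right.2 hA]
  rw [himf] at h1
  rw [himv] at h2
  simp only [Measure.euclideanHausdorffMeasure_def, Measure.smul_apply, h1, ← h2]

section Measure

variable [T3Space M₁] [MeasurableSpace M₁] [BorelSpace M₁] [T3Space M₂] [MeasurableSpace M₂]
  [BorelSpace M₂]

/-- **Local isometries preserve the volume of small sets**: if `d₂(F x, F y) = d₁(x, y)` for
`x, y ∈ U` (`exists_nhds_edist_comp_eq`) and `dim M₁ = dim M₂`, then
`Vol_{g₂}(F(A)) = Vol_{g₁}(A)` for every `A ⊆ U` (the Riemannian measures being the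
Euclidean-normalised Hausdorff measures of the length metrics, Federer 1969, §3.2.46).
[cite: Federer1969, §2.10.11 and §3.2.46] -/
theorem riemannianMeasure_image_eq_of_subset (hg₁ : g₁.IsRiemannian) (hg₂ : g₂.IsRiemannian)
    {U A : Set M₁} (hU : ∀ x ∈ U, ∀ y ∈ U, g₂.edist hg₂ (F x) (F y) = g₁.edist hg₁ x y)
    (hA : A ⊆ U) (hdim : finrank ℝ E₁ = finrank ℝ E₂) :
    riemannianMeasure (g₂.toContMDiffRiemannianMetric hg₂) (F '' A) =
      riemannianMeasure (g₁.toContMDiffRiemannianMetric hg₁) A := by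
  letI iR₁ : RiemannianBundle (fun x : M₁ ↦ TangentSpace I₁ x) :=
    ⟨(g₁.toContMDiffRiemannianMetric hg₁).toContinuousRiemannianMetric.toRiemannianMetric⟩
  letI iR₂ : RiemannianBundle (fun x : M₂ ↦ TangentSpace I₂ x) :=
    ⟨(g₂.toContMDiffRiemannianMetric hg₂).toContinuousRiemannianMetric.toRiemannianMetric⟩
  letI iE₁ : EMetricSpace M₁ := EMetricSpace.ofRiemannianMetric I₁ M₁
  letI iE₂ : EMetricSpace M₂ := EMetricSpace.ofRiemannianMetric I₂ M₂
  have hU' : ∀ x ∈ U, ∀ y ∈ U, edist (F x) (F y) = edist x y := hU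
  rw [Lorentzian.riemannianMeasure, Lorentzian.riemannianMeasure, hdim]
  exact euclideanHausdorffMeasure_image_eq_of_edist_eq hU' hA _

/-- **Evenly covered neighbourhoods are measured `k` times upstairs.** Let `F` be a `C^∞` local
isometry (`g₂(dF v, dF w) = g₁(v, w)`, a local diffeomorphism) between manifolds of the same
dimension with `M₁` compact, and suppose the fibre of `y ∈ M₂` has exactly `k` points. Then
`y` has an open neighbourhood `W` with `Vol_{g₁}(F⁻¹(B)) = k · Vol_{g₂}(B)` for every measurable
`B ⊆ W`: separate the `k` points of the fibre by disjoint open sets (Hausdorff), shrink them to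
the distance-preserving injectivity neighbourhoods `Vᵢ` of `exists_nhds_edist_comp_eq`, and take
`W = ⋂ᵢ F(Vᵢ) ∖ F(M₁ ∖ ⋃ᵢ Vᵢ)`; then `F⁻¹(B) = ⨆ᵢ (Vᵢ ∩ F⁻¹ B)` and `F(Vᵢ ∩ F⁻¹ B) = B`
(Lee 2018, proof of Thm. 6.23; Chavel 2006, §IV.1). [cite: Lee2018, Thm. 6.23 (proof)]
[cite: Chavel2006, §IV.1] -/
theorem exists_nhds_measure_preimage_eq_mul [CompactSpace M₁] [T2Space M₂]
    (hg₁ : g₁.IsRiemannian) (hg₂ : g₂.IsRiemannian) (hF : ContMDiff I₁ I₂ ∞ F)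
    (hloc : IsLocalDiffeomorph I₁ I₂ ∞ F)
    (hiso : ∀ (x : M₁) (v w : TangentSpace I₁ x),
      g₂.val (F x) (mfderiv I₁ I₂ F x v) (mfderiv I₁ I₂ F x w) = g₁.val x v w)
    (hdim : finrank ℝ E₁ = finrank ℝ E₂) {k : ℕ} {y : M₂}
    (hfib : ∃ s : Finset M₁, s.card = k ∧ ∀ x, x ∈ s ↔ F x = y) :
    ∃ W : Set M₂, IsOpen W ∧ y ∈ W ∧ ∀ B ⊆ W, MeasurableSet B →
      riemannianMeasure (g₁.toContMDiffRiemannianMetric hg₁) (F ⁻¹' B) =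
        k * riemannianMeasure (g₂.toContMDiffRiemannianMetric hg₂) B := by
  set μ₁ := riemannianMeasure (g₁.toContMDiffRiemannianMetric hg₁) with hμ₁
  set μ₂ := riemannianMeasure (g₂.toContMDiffRiemannianMetric hg₂) with hμ₂
  obtain ⟨s, hcard, hs⟩ := hfib
  have hF1 : ContMDiff I₁ I₂ 1 F := hF.of_le (by exact_mod_cast (le_top : (1 : ℕ∞) ≤ ⊤))
  -- distance-preserving injectivity neighbourhoods, separated by the Hausdorff property
  choose Uf hUo hxU hinj hUiso using fun x : M₁ ↦
    exists_nhds_edist_comp_eq hg₁ hg₂ hF1 hiso (hloc x)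
  obtain ⟨O, hO, hOdisj⟩ := (s.finite_toSet).t2_separation
  set V : M₁ → Set M₁ := fun x ↦ Uf x ∩ O x with hV
  have hVo : ∀ x, IsOpen (V x) := fun x ↦ (hUo x).inter (hO x).2
  have hxV : ∀ x, x ∈ V x := fun x ↦ ⟨hxU x, (hO x).1⟩
  have hVdisj : (s : Set M₁).PairwiseDisjoint V := fun a ha b hb hab ↦
    (hOdisj ha hb hab).mono inter_subset_right inter_subset_right
  -- the evenly covered neighbourhood
  set C : Set M₂ := F '' (⋃ x ∈ s, V x)ᶜ with hC
  have hCc : IsClosed C :=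
    (((isOpen_biUnion fun x _ ↦ hVo x).isClosed_compl.isCompact).image hF.continuous).isClosed
  set W : Set M₂ := (⋂ x ∈ s, F '' V x) \ C with hW
  have hWo : IsOpen W :=
    (isOpen_biInter_finset fun x _ ↦ hloc.isOpenMap _ (hVo x)).sdiff hCc
  have hyW : y ∈ W := by
    refine ⟨mem_iInter₂.2 fun x hx ↦ ⟨x, hxV x, (hs x).1 hx⟩, ?_⟩
    rintro ⟨z, hz, hzy⟩
    have hzs : z ∈ s := (hs z).2 hzy
    exact hz (mem_iUnion₂.2 ⟨z, hzs, hxV z⟩)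
  refine ⟨W, hWo, hyW, fun B hBW hB ↦ ?_⟩
  -- `F⁻¹(B)` is the disjoint union of the `V x ∩ F⁻¹ B`, `x ∈ s`
  have hpre : F ⁻¹' B = ⋃ x ∈ s, (V x ∩ F ⁻¹' B) := by
    ext z
    simp only [mem_preimage, mem_iUnion, mem_inter_iff, exists_and_right, exists_prop]
    constructor
    · intro hz
      have hzW := hBW hz
      by_contra hcon
      push Not at hcon
      apply hzW.2
      refine ⟨z, fun hzU ↦ ?_, rfl⟩
      obtain ⟨x, hx, hzx⟩ := mem_iUnion₂.1 hzU
      exact hcon ⟨x, hx, hzx⟩ hz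
    · rintro ⟨-, hz⟩
      exact hz
  have hmeasV : ∀ x, MeasurableSet (V x ∩ F ⁻¹' B) := fun x ↦
    (hVo x).measurableSet.inter (hB.preimage hF.continuous.measurable)
  have hdisj : (s : Set M₁).PairwiseDisjoint fun x ↦ V x ∩ F ⁻¹' B := fun a ha b hb hab ↦
    (hVdisj ha hb hab).mono inter_subset_left inter_subset_left
  -- each piece is carried onto `B`
  have himg : ∀ x ∈ s, F '' (V x ∩ F ⁻¹' B) = B := by
    intro x hx
    refine Subset.antisymm ?_ fun b hb ↦ ?_
    · rintro _ ⟨z, hz, rfl⟩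
      exact hz.2
    · obtain ⟨v, hv, rfl⟩ := mem_iInter₂.1 (hBW hb).1 x hx
      exact ⟨v, ⟨hv, hb⟩, rfl⟩
  have hpiece : ∀ x ∈ s, μ₁ (V x ∩ F ⁻¹' B) = μ₂ B := by
    intro x hx
    have h := riemannianMeasure_image_eq_of_subset hg₁ hg₂ (hUiso x) (A := V x ∩ F ⁻¹' B)
      (inter_subset_left.trans inter_subset_left) hdim
    rw [himg x hx] at h
    rw [hμ₁, hμ₂, ← h]
  rw [hpre, measure_biUnion_finset hdisj fun x _ ↦ hmeasV x,
    Finset.sum_congr rfl hpiece, Finset.sum_const, hcard, nsmul_eq_mul]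

/-- **The volume of a finite-sheeted Riemannian covering**: `Vol_{g₁}(M₁) = k · Vol_{g₂}(M₂)`
for a surjective `C^∞` local isometry `F : M₁ → M₂` (`g₂(dF v, dF w) = g₁(v, w)`, a local
diffeomorphism, `dim M₁ = dim M₂`) from a compact manifold all of whose fibres have exactly `k`
points (Lee 2018, Problem 2-14: a `k`-sheeted Riemannian covering of compact connected
manifolds multiplies volume by `k`; Chavel 2006, Exercise IV.18: `V(M) = V(M_o) · card Γ`). Proof: the evenly covered neighbourhoods of
`exists_nhds_measure_preimage_eq_mul` cover the compact `M₂`; refine a finite subcover to a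
finite measurable partition `(B_j)` of `M₂` (`disjointed`); then
`Vol(M₁) = Σ_j Vol(F⁻¹ B_j) = Σ_j k Vol(B_j) = k Vol(M₂)`. [cite: Lee2018, Problem 2-14]
[cite: Chavel2006, Exercise IV.18] -/
theorem riemannianMeasure_univ_eq_mul_of_card_fibre [CompactSpace M₁] [T2Space M₂]
    (hg₁ : g₁.IsRiemannian) (hg₂ : g₂.IsRiemannian) (hF : ContMDiff I₁ I₂ ∞ F)
    (hloc : IsLocalDiffeomorph I₁ I₂ ∞ F)
    (hiso : ∀ (x : M₁) (v w : TangentSpace I₁ x),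
      g₂.val (F x) (mfderiv I₁ I₂ F x v) (mfderiv I₁ I₂ F x w) = g₁.val x v w)
    (hdim : finrank ℝ E₁ = finrank ℝ E₂) (hsurj : Surjective F) {k : ℕ}
    (hfib : ∀ y : M₂, ∃ s : Finset M₁, s.card = k ∧ ∀ x, x ∈ s ↔ F x = y) :
    riemannianMeasure (g₁.toContMDiffRiemannianMetric hg₁) univ =
      k * riemannianMeasure (g₂.toContMDiffRiemannianMetric hg₂) univ := by
  set μ₁ := riemannianMeasure (g₁.toContMDiffRiemannianMetric hg₁) with hμ₁
  set μ₂ := riemannianMeasure (g₂.toContMDiffRiemannianMetric hg₂) with hμ₂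
  choose W hWo hyW hWk using fun y : M₂ ↦
    exists_nhds_measure_preimage_eq_mul hg₁ hg₂ hF hloc hiso hdim (hfib y)
  -- a finite subcover of the compact `M₂ = F(M₁)`
  have hcpt : IsCompact (univ : Set M₂) := by
    rw [← hsurj.range_eq]
    exact isCompact_range hF.continuous
  obtain ⟨t, ht⟩ := hcpt.elim_finite_subcover W hWo fun y _ ↦ mem_iUnion.2 ⟨y, hyW y⟩
  -- enumerate it and disjointify
  set e := t.equivFin with he
  set U' : ℕ → Set M₂ := fun i ↦ if h : i < t.card then W (e.symm ⟨i, h⟩ : M₂) else ∅ with hU'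
  have hU'meas : ∀ i, MeasurableSet (U' i) := by
    intro i
    by_cases h : i < t.card
    · simp only [hU', dif_pos h]; exact (hWo _).measurableSet
    · simp only [hU', dif_neg h]; exact MeasurableSet.empty
  have hU'cover : (⋃ i, U' i) = univ := by
    refine eq_univ_of_forall fun z ↦ ?_
    obtain ⟨y', hy'⟩ := mem_iUnion.1 (ht (mem_univ z))
    obtain ⟨hy't, hzy'⟩ := mem_iUnion.1 hy'
    refine mem_iUnion.2 ⟨(e ⟨y', hy't⟩ : ℕ), ?_⟩
    have hlt : ((e ⟨y', hy't⟩ : Fin t.card) : ℕ) < t.card := (e ⟨y', hy't⟩).2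
    simp only [hU', dif_pos hlt, Fin.eta, Equiv.symm_apply_apply]
    exact hzy'
  set D : ℕ → Set M₂ := disjointed U' with hD
  have hDmeas : ∀ i, MeasurableSet (D i) := fun i ↦ MeasurableSet.disjointed hU'meas i
  have hDdisj : Pairwise (Disjoint on D) := disjoint_disjointed U'
  have hDcover : (⋃ i, D i) = univ := by rw [hD, iUnion_disjointed, hU'cover]
  -- each `D i` is evenly covered
  have hDk : ∀ i, μ₁ (F ⁻¹' D i) = k * μ₂ (D i) := by
    intro i
    by_cases h : i < t.card
    · refine hWk (e.symm ⟨i, h⟩ : M₂) (D i) ?_ (hDmeas i)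
      have hsub : D i ⊆ U' i := disjointed_subset U' i
      simp only [hU', dif_pos h] at hsub
      exact hsub
    · have hempty : D i = ∅ := by
        refine subset_empty_iff.1 ?_
        have hsub : D i ⊆ U' i := disjointed_subset U' i
        simp only [hU', dif_neg h] at hsub
        exact hsub
      simp [hempty]
  -- sum up
  have h1 : μ₁ univ = ∑' i, μ₁ (F ⁻¹' D i) := by
    rw [← preimage_univ (f := F), ← hDcover, preimage_iUnion,
      measure_iUnion (fun i j hij ↦ (hDdisj hij).preimage F)
        fun i ↦ (hDmeas i).preimage hF.continuous.measurable]
  have h2 : μ₂ univ = ∑' i, μ₂ (D i) := by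
    rw [← hDcover, measure_iUnion hDdisj hDmeas]
  rw [h1, h2, ← ENNReal.tsum_mul_left]
  exact tsum_congr hDk

end Measure

end RiemannianCovering

end Literature.Geometry.Riemannian

end
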